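import Summits.AtomisticToContinuum.FouriersLaw.Theorems.BondHeatUncertaintySubdiffusiveBondHeatDeficitCesaroLinear
import Summits.AtomisticToContinuum.FouriersLaw.Theorems.BondHeatUncertaintySubdiffusiveBondHeatEscapeDeficitNonneg

/-!
# The escape deficit is at most one: `0 ≤ E_N ≤ 1`

Crux `stmt-AtomisticToContinuum-9120` (`BondHeatUncertainty.SubdiffusiveBondHeat`, (S)), line `bath-bond-deficit-integral`;
notation VERBATIM the `let K / θ / E` of route `BoundaryEscapeDeficit`: `K_N(u) = ∫ (p₀² − T)·P_u(p₀² − T) dμ_T^N`,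
`θ_N(s) = (γ/T²)∫₀ˢ K_N`, `E_N = 1 − (γ/T²)∫_{(0,∞)} K_N`.

* `pinnedChain_escapeDeficit_le_one` — **`E_N ≤ 1` for every `N ≥ 1`**, i.e. `0 ≤ ∫₀^∞ K_N`: the asymptotic variance of
  the time-integrated boundary kinetic observable is nonnegative.  Proof (same template as `E_N ≥ 0`): `∫₀ᵗ θ_N(s) ds =
  (γ/T²)∫₀ᵗ∫₀ˢ K_N ≥ 0` for all `t` (`pinnedChain_primitive_kinKernel_integral_nonneg`: it is `(γ/2T²)·E[(∫₀ᵗ(p₀²−T)(z_s)ds)²]`),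
  while `θ_N(s) = (1 − E_N) − (1 − θ_N(s) − E_N)` with a bounded once-integrated transient
  (`pinnedChain_abs_transientIntegral_le_fixedN`); so `t(1 − E_N) ≥ −B_N` for all `t ≥ 0`, forcing `E_N ≤ 1`;
* `escapeDeficit_le_one` — the `∀`-form in the route's `dite` spelling (every `N : ℕ`; for `N = 0` the junk value is `E = 1`);
* `escapeDeficit_mem_Icc` — with the landed `escapeDeficit_nonneg`: **`E_N ∈ [0, 1]` for every `N ≥ 2`** — the escape
  deficit of route `BoundaryEscapeDeficit` (whose items `EscapeLaw` 12234, `DiffusiveCrossover` 12236, `EscapeNonOscillation`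
  12238 all speak about `(N−1)γE_N`) is a genuine FRACTION, unconditionally; in particular the contact Green–Kubo integral
  satisfies `0 ≤ (γ/T²)∫₀^∞ K_N ≤ 1`.

Fixed-`N` facts; nothing here closes an item.
-/

noncomputable section

open MeasureTheory Set Filter Topology intervalIntegral

namespace Summit.AtomisticToContinuum.FouriersLaw.Theorems.SubdiffusiveBondHeat

open Literature.MathematicalPhysics.KineticTheory.HeatConduction

section FixedN

variable {ω₂ lam β γ : ℝ} (hω : 0 < ω₂) (hl : 0 < lam) (hβ : 0 < β) (hγ : 0 < γ) {N : ℕ} (hN : 0 < N)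
  {T : ℝ} (hT : 0 < T)
include hω hl hβ hγ hN hT

/-- **`E_N ≤ 1`** (`N ≥ 1`): `(γ/T²)∫_{(0,∞)} K_N ≥ 0`.  For all `t ≥ 0`, `0 ≤ (γ/T²)∫₀ᵗ∫₀ˢ K_N = ∫₀ᵗ θ_N =
t(1 − E_N) − ∫₀ᵗ(1 − θ_N − E_N) ≤ t(1 − E_N) + B_N`, so `1 − E_N ≥ 0`. [folklore] -/
theorem pinnedChain_escapeDeficit_le_one :
    1 - γ / T ^ 2 * (∫ u in Set.Ioi (0 : ℝ),
      if h : 0 < N then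
        ∫ z, ((z.2 ⟨0, h⟩) ^ 2 - T) *
            (∫ y, ((y.2 ⟨0, h⟩) ^ 2 - T) ∂((pinnedChain ω₂ lam β γ).transitionKernel N T T u.toNNReal z))
          ∂((pinnedChain ω₂ lam β γ).gibbsMeasure N T)
      else 0) ≤ 1 := by
  -- the two-sided transient bound (dite spelling) and the nonnegative iterated primitive
  obtain ⟨B, hB⟩ := pinnedChain_abs_transientIntegral_le_fixedN hω hl hβ hγ hN hT
  simp only [dif_pos hN] at hB ⊢
  set K : ℝ → ℝ := fun u => ∫ z, ((z.2 ⟨0, hN⟩) ^ 2 - T) *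
      (∫ y, ((y.2 ⟨0, hN⟩) ^ 2 - T) ∂((pinnedChain ω₂ lam β γ).transitionKernel N T T u.toNNReal z))
    ∂((pinnedChain ω₂ lam β γ).gibbsMeasure N T) with hK
  set E : ℝ := 1 - γ / T ^ 2 * ∫ u in Set.Ioi (0 : ℝ), K u with hE
  -- continuity of the primitive
  obtain ⟨-, hKc, -, -, -⟩ := boundaryKernelBasics_proof ω₂ lam β γ hω hl hβ hγ T hT N hN
  simp only [dif_pos hN] at hKc
  have hFc : Continuous fun s : ℝ => ∫ u in (0 : ℝ)..s, K u :=
    intervalIntegral.continuous_primitive (fun a b => hKc.intervalIntegrable a b) 0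
  have hγT : 0 ≤ γ / T ^ 2 := div_nonneg hγ.le (by positivity)
  -- `t (1 - E) ≥ -B` for all `t ≥ 0`
  have hlow : ∀ t : ℝ, 0 ≤ t → -B ≤ t * (1 - E) := by
    intro t ht
    have hpos : 0 ≤ ∫ s in (0 : ℝ)..t, (∫ u in (0 : ℝ)..s, K u) := by
      simpa only [hK] using pinnedChain_primitive_kinKernel_integral_nonneg hω hl hβ hγ hT hN ht
    have hTr : -B ≤ ∫ s in (0 : ℝ)..t, ((1 - γ / T ^ 2 * ∫ u in (0 : ℝ)..s, K u) - E) :=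
      neg_le_of_abs_le (hB t ht)
    -- `(γ/T²)∫₀ᵗ∫₀ˢ K = t (1 - E) - ∫₀ᵗ transient`
    have hFi : IntervalIntegrable (fun s : ℝ => ∫ u in (0 : ℝ)..s, K u) volume 0 t := hFc.intervalIntegrable 0 t
    have hθi : IntervalIntegrable (fun s : ℝ => γ / T ^ 2 * ∫ u in (0 : ℝ)..s, K u) volume 0 t := hFi.const_mul _
    have hid : (∫ s in (0 : ℝ)..t, ((1 - γ / T ^ 2 * ∫ u in (0 : ℝ)..s, K u) - E)) =
        t * (1 - E) - γ / T ^ 2 * ∫ s in (0 : ℝ)..t, (∫ u in (0 : ℝ)..s, K u) := by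
      have h1 : (fun s : ℝ => (1 - γ / T ^ 2 * ∫ u in (0 : ℝ)..s, K u) - E) =
          fun s : ℝ => (1 - E : ℝ) - γ / T ^ 2 * ∫ u in (0 : ℝ)..s, K u := by
        funext s; ring
      rw [h1, intervalIntegral.integral_sub intervalIntegrable_const hθi, intervalIntegral.integral_const, sub_zero,
        smul_eq_mul, intervalIntegral.integral_const_mul]
    rw [hid] at hTr
    nlinarith [mul_nonneg hγT hpos]
  -- conclude
  by_contra hneg
  have hlt : 1 < E := not_le.mp hneg
  have hE0 : 0 < E - 1 := by linarith
  have ht0 : 0 ≤ (|B| + 1) / (E - 1) := by positivity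
  have key := hlow _ ht0
  have hEne : E - 1 ≠ 0 := hE0.ne'
  have hmul : (|B| + 1) / (E - 1) * (1 - E) = -(|B| + 1) := by
    have : (|B| + 1) / (E - 1) * (1 - E) = -((|B| + 1) * ((E - 1) / (E - 1))) := by ring
    rw [this, div_self hEne, mul_one]
  rw [hmul] at key
  linarith [neg_le_abs B, le_abs_self B]

end FixedN

/-- **`E_N ≤ 1` in the route's spelling**, every `N : ℕ` (for `N = 0` the kernel is the junk `0` and `E = 1`). [folklore] -/
theorem escapeDeficit_le_one :
    ∀ ω₂ lam β γ : ℝ, 0 < ω₂ → 0 < lam → 0 < β → 0 < γ → ∀ T : ℝ, 0 < T → ∀ N : ℕ,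
      1 - γ / T ^ 2 * (∫ u in Set.Ioi (0 : ℝ),
        if h : 0 < N then
          ∫ z, ((z.2 ⟨0, h⟩) ^ 2 - T) *
              (∫ y, ((y.2 ⟨0, h⟩) ^ 2 - T) ∂((pinnedChain ω₂ lam β γ).transitionKernel N T T u.toNNReal z))
            ∂((pinnedChain ω₂ lam β γ).gibbsMeasure N T)
        else 0) ≤ 1 := by
  intro ω₂ lam β γ hω hl hβ hγ T hT N
  rcases Nat.eq_zero_or_pos N with h0 | hN
  · subst h0
    simp
  · exact pinnedChain_escapeDeficit_le_one hω hl hβ hγ hN hT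

/-- **The escape deficit is a fraction: `E_N ∈ [0, 1]` for every `N ≥ 2`** (`escapeDeficit_nonneg` ∧ `escapeDeficit_le_one`),
unconditionally: `0 ≤ (γ/T²)∫₀^∞ K_N ≤ 1`. [folklore] -/
theorem escapeDeficit_mem_Icc :
    ∀ ω₂ lam β γ : ℝ, 0 < ω₂ → 0 < lam → 0 < β → 0 < γ → ∀ T : ℝ, 0 < T → ∀ N : ℕ, 2 ≤ N →
      (1 - γ / T ^ 2 * (∫ u in Set.Ioi (0 : ℝ),
        if h : 0 < N then
          ∫ z, ((z.2 ⟨0, h⟩) ^ 2 - T) *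
              (∫ y, ((y.2 ⟨0, h⟩) ^ 2 - T) ∂((pinnedChain ω₂ lam β γ).transitionKernel N T T u.toNNReal z))
            ∂((pinnedChain ω₂ lam β γ).gibbsMeasure N T)
        else 0)) ∈ Set.Icc (0 : ℝ) 1 := by
  intro ω₂ lam β γ hω hl hβ hγ T hT N hN
  exact ⟨escapeDeficit_nonneg ω₂ lam β γ hω hl hβ hγ T hT N hN, escapeDeficit_le_one ω₂ lam β γ hω hl hβ hγ T hT N⟩

end Summit.AtomisticToContinuum.FouriersLaw.Theorems.SubdiffusiveBondHeat

end
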